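import Summits.BirchSwinnertonDyer.BirchSwinnertonDyer.Theorems.KolyvaginDepthDoorDepthTableKuriharaDecisivePrime
import Summits.BirchSwinnertonDyer.BirchSwinnertonDyer.Theorems.KolyvaginDepthDoorDepthTableKuriharaDecisive709a1
import Summits.BirchSwinnertonDyer.Rank1Residual.Supersingular.CountPointsFast
import HarnessLib

/-!
# Route `KolyvaginDepthDoor`, crux `KolyvaginDepthSupplyKN` (stmt-BirchSwinnertonDyer-22820) —
# DEPTH TABLE v19, ROW `709a1` @ `(5, d_K = -7)`: A SECOND DECISIVE PRIME `ℓ★₂ = 211` AND THE AGREEMENT TEST `δ̃_71 unit ⟺ δ̃_211 unit` — the row's bit ⟺ a unit mod-`5`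
# Kurihara number of the twist model `T₀ = [0, 1, 1, -114, 130]` AT THE ONE PRIME `211` (kernel: `47 • P̄ ≠ O` in `T̃₀(𝔽_211)` for
# `P = (-5, 24)`, `#T̃₀(𝔽_211) = 235 = 5·47`)

Helper file of the lead prover of line `levelone` (kdd-p1 g23; `--supports stmt-BirchSwinnertonDyer-22820
--as helper`); it closes nothing and BSD is NOT proved by it. Sequel of `…KuriharaDecisive709a1` (first decisive prime `71`): a SECOND decisive prime `211` by the same template, and the AGREEMENT COROLLARY `unit_71_iff_unit_211` — modulo print the two residues `δ̃_71(T₀)`, `δ̃_211(T₀)` are BOTH units or BOTH zero (each is ⟺ the row's bit): an internal consistency test of the fleet's modular-symbol engine at level `N_{T₀}`, falsifiable by two residues.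

v18 (g22, `…KuriharaSocket709a1`) read the row EXACTLY as «bit ⟺ SOME cyclic Kolyvagin prime `ℓ` of `(T₀, 5)` carries
a unit `δ̃_ℓ(T₀)`», and CLOSING-DATA-v18 §2b marked `ℓ = 211` with ★ (the known point `P = (-5, 24)` of `T₀` is not
divisible by `5` in `T̃₀(𝔽_211)` — a heuristic there). v19 makes the ★ a THEOREM-LEVEL statement: by the generic
`…KuriharaDecisivePrime` (Sakamoto 2022 Lemma 4.4 + Lemma 4.6 (1) BY NAME, `hSak3`), the bit — which gives `#Sel_5(E^{(-7)}) ≤ 5`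
by the row's exact reading — FORCES `δ̃_211(T₀) ≢ 0 (mod 5)`, the local `5`-indivisibility of `P` at `211` being
KERNEL-CHECKED here (`minTwist7_localNondivisible_211`: an affine double-and-add chain of 9 certified steps reaching
`47 • P̄ = (59, 55) ≠ O` in `T̃₀(𝔽_211)` by `decide`, `5·47 = #T̃₀(𝔽_211) = 235`, and the bridge `localNondivisible_of_chainB`).
Conversely a unit at `211` closes the row by the socket. HENCE

* `twistKuriharaBit_iff_unit_211` — **bit ⟺ unit `δ̃_211(T₀)`** (for every admissible datum of `T₀`): the fleet's ONE
  residue `δ̃_211(T₀) mod 5` DECIDES the row `709a1` @ `(5, -7)` BOTH WAYS modulo print — a computed ZERO refutes the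
  crux's clause at `(5, ℚ(√-7))` for `709a1` (the row then moves to another admissible prime / Heegner field), a UNIT proves it.

Kernel lemmas: `minTwist7_card_211` (`#T̃₀(𝔽_211) = 235`, `a_211(T₀) = -23 ≡ 2 (mod 5)`), `minTwist7_isCyclicKolyvaginLevel_5_211`,
`minTwist7_localNondivisible_211`. CONDITIONAL on the named facts displayed and the E-side record claim `hδE`; per curve; nothing
class-wide; BSD is NOT proved by any of this.

References: [Sakamoto2022pSelmer] Lemma 4.4, Lemma 4.6 (1), Thm. 1.2, Thm. 1.5; [Kim2022StructureSelmer] Thm. 1.11;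
[Kurihara2014] §5.3; [SilvermanAEC2009] III.2.3, VII.2.1, VII.3.1; [CremonaAlgorithms1997] Table 1 (709a1).
-/

set_option linter.dupNamespace false

noncomputable section

open scoped Classical NumberField

namespace Summit.BirchSwinnertonDyer.BirchSwinnertonDyer.Theorems.KolyvaginDepthDoor

open Literature.NumberTheory.EllipticCurves Literature.NumberTheory.EllipticCurves.ModularForms
  WeierstrassCurve NumberField IsDedekindDomain
open Summit.BirchSwinnertonDyer.BirchSwinnertonDyer.Theorems
open Summit.BirchSwinnertonDyer.BirchSwinnertonDyer.Rank2Observatory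
open Summit.BirchSwinnertonDyer.BirchSwinnertonDyer.Rank1Residual (IntModel.frobeniusTrace_eq)
open Summit.BirchSwinnertonDyer.Rank1Residual.Supersingular (natCard_point_eq_of_countPoints countPoints_eq_of_fast)
open Summit.BirchSwinnertonDyer.Rank1Residual.Additive (card_torsion_le_of_intModel_of_card
  isKolyvaginPrime_of_intModel_of_card)

namespace C709a1

/-- `#T̃₀(𝔽_211) = 235 = 5·47` for `T₀ = [0, 1, 1, -114, 130]` (`211 ≡ 1 (mod 5)`, `a_211(T₀) = -23 ≡ 2 (mod 5)`, `5² ∤ 235`),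
kernel-decided (`countPointsFast`). [cite: Kim2022StructureSelmer, §1.2.2 (PDF p. 5)] -/
theorem minTwist7_card_211 :
    Nat.card (((⟨0, 1, 1, -114, 130⟩ : WeierstrassCurve ℤ).map (Int.castRingHom (ZMod 211))).toAffine.Point) = 235 :=
  haveI : Fact (Nat.Prime 211) := ⟨by norm_num⟩
  natCard_point_eq_of_countPoints 0 1 1 (-114) 130 211 (by norm_num) (by decide +kernel) (n := 235)
    (countPoints_eq_of_fast (by decide +kernel))

/-- **`211` is a CYCLIC KOLYVAGIN PRIME for `(T₀, 5)`** (`211 ∤ 5·N_{T₀}`, `211 ≡ 1`, `a_211(T₀) ≡ 2 (mod 5)`,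
`#T̃₀(𝔽_211)[5] ≤ 5`) — a ★ candidate of CLOSING-DATA-v18 §2b. [cite: Kim2022StructureSelmer, §1.2.2 (PDF p. 5)] -/
theorem minTwist7_isCyclicKolyvaginLevel_5_211 :
    haveI := minTwist7_isGloballyMinimal; haveI := Fact.mk (by norm_num : Nat.Prime 5);
    IsCyclicKolyvaginLevel ((⟨0, 1, 1, -114, 130⟩ : WeierstrassCurve ℤ).map (Int.castRingHom ℚ)) 5 211 := by
  haveI := minTwist7_isElliptic
  haveI := minTwist7_isGloballyMinimal
  haveI := Fact.mk (by norm_num : Nat.Prime 5)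
  haveI : Fact (Nat.Prime 211) := ⟨by norm_num⟩
  have hℓ : Kato.IsKolyvaginPrime ((⟨0, 1, 1, -114, 130⟩ : WeierstrassCurve ℤ).map (Int.castRingHom ℚ)) 5 1 211 :=
    isKolyvaginPrime_of_intModel_of_card minTwist7_intModel 5 1 211 (by norm_num) (by decide +kernel) (by decide)
      minTwist7_card_211 (by norm_num)
  refine ⟨⟨Nat.squarefree_iff_nodup_primeFactorsList (by norm_num) |>.mpr (by simp), fun ℓ hℓ' ↦ ?_⟩, fun ℓ hℓ' hdvd ↦ ?_⟩
  · rw [show (211 : ℕ).primeFactors = {211} from (Nat.Prime.primeFactors (by norm_num)), Finset.mem_singleton] at hℓ'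
    exact hℓ' ▸ hℓ
  · obtain rfl := (Nat.prime_dvd_prime_iff_eq hℓ'.out (by norm_num)).mp hdvd
    exact card_torsion_le_of_intModel_of_card minTwist7_intModel 5 211 minTwist7_card_211 (by norm_num)

/-- The double-and-add chain from `P̄` reaches the multiplier `47`. [folklore] -/
theorem chain211_mult :
    chainMult 1 [(true, ((10 : ℤ) : ZMod 211), ((201 : ℤ) : ZMod 211)), (true, ((155 : ℤ) : ZMod 211), ((93 : ℤ) : ZMod 211)), (false, ((129 : ℤ) : ZMod 211), ((57 : ℤ) : ZMod 211)), (true, ((48 : ℤ) : ZMod 211), ((76 : ℤ) : ZMod 211)), (false, ((176 : ℤ) : ZMod 211), ((96 : ℤ) : ZMod 211)), (true, ((74 : ℤ) : ZMod 211), ((25 : ℤ) : ZMod 211)), (false, ((205 : ℤ) : ZMod 211), ((178 : ℤ) : ZMod 211)), (true, ((118 : ℤ) : ZMod 211), ((134 : ℤ) : ZMod 211)), (false, ((59 : ℤ) : ZMod 211), ((55 : ℤ) : ZMod 211))] = 47 := by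
  decide

/-- The double-and-add chain from `P̄ = (-5, 24)` to `47 • P̄ = (59, 55)` in `T̃₀(𝔽_211)` CHECKS (tangent / chord
certificates, `decide`). [cite: SilvermanAEC2009, III.2.3] -/
theorem chain211_ok :
    chainB (⟨0, 1, 1, -114, 130⟩ : WeierstrassCurve ℤ) 211 (((-5 : ℤ)) : ZMod 211) (((24 : ℤ)) : ZMod 211)
      ((((-5 : ℤ)) : ZMod 211), (((24 : ℤ)) : ZMod 211))
      [(true, ((10 : ℤ) : ZMod 211), ((201 : ℤ) : ZMod 211)), (true, ((155 : ℤ) : ZMod 211), ((93 : ℤ) : ZMod 211)), (false, ((129 : ℤ) : ZMod 211), ((57 : ℤ) : ZMod 211)), (true, ((48 : ℤ) : ZMod 211), ((76 : ℤ) : ZMod 211)), (false, ((176 : ℤ) : ZMod 211), ((96 : ℤ) : ZMod 211)), (true, ((74 : ℤ) : ZMod 211), ((25 : ℤ) : ZMod 211)), (false, ((205 : ℤ) : ZMod 211), ((178 : ℤ) : ZMod 211)), (true, ((118 : ℤ) : ZMod 211), ((134 : ℤ) : ZMod 211)), (false, ((59 : ℤ) : ZMod 211), ((55 : ℤ) :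 ZMod 211))] = true := by
  decide +kernel

/-- **KERNEL: `P = (-5, 24)` is not divisible by `5` in `T₀(ℚ_211)`** — the chain certifies `47 • P̄ ≠ O` in `T̃₀(𝔽_211)`,
`5·47 = #T̃₀(𝔽_211)`, and `localNondivisible_of_chainB`. This is the ★ of CLOSING-DATA-v18 §2b for `709a1` at `211`, now in
the kernel. [cite: SilvermanAEC2009, III.2.3, VII.2 Prop. 2.1, VII.3 Prop. 3.1] -/
theorem minTwist7_localNondivisible_211 :
    haveI : Fact (Nat.Prime 211) := ⟨by norm_num⟩;
    ∀ Q : (((⟨0, 1, 1, -114, 130⟩ : WeierstrassCurve ℤ).map (Int.castRingHom ℚ)).baseChange ℚ_[211]).toAffine.Point,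
      5 • Q ≠ WeierstrassCurve.Affine.Point.map (W' := ((⟨0, 1, 1, -114, 130⟩ : WeierstrassCurve ℤ).map (Int.castRingHom ℚ)).toAffine)
        (S := ℚ) (Algebra.ofId ℚ ℚ_[211]) (.some ((-5 : ℤ) : ℚ) ((24 : ℤ) : ℚ) minTwist7_nonsingular_P) := by
  haveI : Fact (Nat.Prime 211) := ⟨by norm_num⟩
  have hq : ¬ ((211 : ℕ) : ℤ) ∣ (⟨0, 1, 1, -114, 130⟩ : WeierstrassCurve ℤ).Δ := by decide +kernel
  have hXY : (⟨0, 1, 1, -114, 130⟩ : WeierstrassCurve ℤ).toAffine.Equation (-5) (24) :=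
    (Affine.equation_iff _ _).mpr (by norm_num)
  have hpk : 5 * 47 = Nat.card (((⟨0, 1, 1, -114, 130⟩ : WeierstrassCurve ℤ).map (Int.castRingHom (ZMod 211))).toAffine.Point) := by
    rw [minTwist7_card_211]
  exact localNondivisible_of_chainB (⟨0, 1, 1, -114, 130⟩ : WeierstrassCurve ℤ) 211 hq hXY minTwist7_nonsingular_P hpk
    chain211_mult (by convert chain211_ok)

/-- **ROW `709a1` @ `(5, -7)`: THE DECISIVE PRIME `211` — bit ⟺ unit `δ̃_211(T₀)`.** For every imaginary quadratic `K`
with `d_K = -7`, granted the named facts displayed and the E-side record claim `hδE`: «some frame, some Kolyvagin PRIME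
`ℓ`, some Kolyvagin–Heegner datum of conductor `ℓ` with `c_1(ℓ) ≠ 0`» (the depth-table bit) holds IF AND ONLY IF «every
datum `D` of `T₀` at level `N_{T₀}` with `5 ∤ c_D` and the period transfer has a UNIT mod-`5` Kurihara number AT `211`» —
the claim of a future tree record `cert_<T₀>` @ `(5, 211)`. (⟹): bit ⟹ `#Sel_5(E^{(-7)}) ≤ 5` (the socket's exact reading
∘ v18's twist IFF) ⟹ unit at `211` (`twistKuriharaClaim_prime_of_natCard_selmerGroup_le` with the kernel certificate
`minTwist7_localNondivisible_211`); (⟸): the exact reading with `m = 211` (`minTwist7_isCyclicKolyvaginLevel_5_211`, `ν(211) = 1`).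
CONDITIONAL on the named facts and the claim; per curve; BSD is not proved by it.
[cite: Sakamoto2022pSelmer, Lemma 4.4, Lemma 4.6 (1), Thm. 1.2, Thm. 1.5] [cite: Kim2022StructureSelmer, Thm. 1.11]
[cite: CremonaAlgorithms1997, Table 1 (709a1)] -/
theorem twistKuriharaBit_iff_unit_211
    (h372 : GrossLMS1991.prop37_2_frobeniusCongruence)
    (h84 : Literature.NumberTheory.EllipticCurves.WZhang2014_lemma84_exists_minimal_kolyvaginClass_one_selmerCard)
    (hKim : Kim2022_card_selmerGroup_le_pow_of_kuriharaNumber_ne_zero)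
    (hSak1 : Sakamoto2022_card_selmerGroup_eq_pow_of_isDeltaMinimal)
    (hSak2 : Sakamoto2022_exists_cyclicLevel_kuriharaNumber_ne_zero)
    (hSak3 : Literature.NumberTheory.EllipticCurves.Sakamoto2022_kuriharaNumber_prime_ne_zero_of_localNondivisible)
    (hnf : exists_isNewformOf) (hMaz : mazur_not_dvd_maninConstant_of_odd)
    (K : Type) [Field K] [NumberField K] (hK : IsImaginaryQuadratic K) (hD : NumberField.discr K = -7)
    (hδE : haveI := isElliptic_c709a1; haveI := isGloballyMinimal_c709a1;
      haveI : NeZero (((⟨0, -1, 1, -2, 0⟩ : WeierstrassCurve ℤ).map (Int.castRingHom ℚ)).conductorNorm ℤ) := neZero_conductorNorm_of_isElliptic _;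
      haveI := Fact.mk (by norm_num : Nat.Prime 5);
      ∀ (D : ModularParametrizationData ((⟨0, -1, 1, -2, 0⟩ : WeierstrassCurve ℤ).map (Int.castRingHom ℚ)) (((⟨0, -1, 1, -2, 0⟩ : WeierstrassCurve ℤ).map (Int.castRingHom ℚ)).conductorNorm ℤ)), ¬ ((5 : ℕ) : ℤ) ∣ D.maninConstant →
        (∃ u : ℚ, ‖(u : ℚ_[5])‖ = 1 ∧ ((⟨0, -1, 1, -2, 0⟩ : WeierstrassCurve ℤ).map (Int.castRingHom ℚ)).realPeriodRat = u * plusPeriod D.f) →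
        ∃ ψ : (ℓ : ℕ) → (ZMod ℓ)ˣ →* Multiplicative (ZMod 5),
          (∀ ℓ ∈ (7171 : ℕ).primeFactors, Function.Surjective (ψ ℓ)) ∧ kuriharaNumber D.f 5 7171 ψ ≠ 0) :
    haveI := isElliptic_c709a1; haveI := isGloballyMinimal_c709a1;
    haveI : NeZero (((⟨0, -1, 1, -2, 0⟩ : WeierstrassCurve ℤ).map (Int.castRingHom ℚ)).conductorNorm ℤ) := neZero_conductorNorm_of_isElliptic _;
    haveI := minTwist7_isElliptic; haveI := minTwist7_isGloballyMinimal;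
    haveI : NeZero (((⟨0, 1, 1, -114, 130⟩ : WeierstrassCurve ℤ).map (Int.castRingHom ℚ)).conductorNorm ℤ) := neZero_conductorNorm_of_isElliptic _;
    haveI := Fact.mk (by norm_num : Nat.Prime 5);
    (∃ (Dt : ModularParametrizationData ((⟨0, -1, 1, -2, 0⟩ : WeierstrassCurve ℤ).map (Int.castRingHom ℚ)) (((⟨0, -1, 1, -2, 0⟩ : WeierstrassCurve ℤ).map (Int.castRingHom ℚ)).conductorNorm ℤ)) (β : ℤ)
      (ι : K →+* ℂ) (ℓ : ℕ) (d : KolyvaginHeegnerData Dt β ι ℓ),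
      ℓ.Prime ∧ Zhang2014.IsKolyvaginPrime (((⟨0, -1, 1, -2, 0⟩ : WeierstrassCurve ℤ).map (Int.castRingHom ℚ)).conductorNorm ℤ) ((⟨0, -1, 1, -2, 0⟩ : WeierstrassCurve ℤ).map (Int.castRingHom ℚ)) K 5 ℓ ∧
        d.kolyvaginClass (p := 5) (by norm_num) 1 ≠ 0) ↔
    (∀ (D : ModularParametrizationData ((⟨0, 1, 1, -114, 130⟩ : WeierstrassCurve ℤ).map (Int.castRingHom ℚ))
          (((⟨0, 1, 1, -114, 130⟩ : WeierstrassCurve ℤ).map (Int.castRingHom ℚ)).conductorNorm ℤ)),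
        ¬ ((5 : ℕ) : ℤ) ∣ D.maninConstant →
        (∃ u : ℚ, ‖(u : ℚ_[5])‖ = 1 ∧
          ((⟨0, 1, 1, -114, 130⟩ : WeierstrassCurve ℤ).map (Int.castRingHom ℚ)).realPeriodRat = u * plusPeriod D.f) →
        ∃ ψ : (q : ℕ) → (ZMod q)ˣ →* Multiplicative (ZMod 5),
          (∀ q ∈ (211 : ℕ).primeFactors, Function.Surjective (ψ q)) ∧ kuriharaNumber D.f 5 211 ψ ≠ 0) := by
  haveI := isElliptic_c709a1
  haveI := isGloballyMinimal_c709a1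
  haveI iNZ : NeZero (((⟨0, -1, 1, -2, 0⟩ : WeierstrassCurve ℤ).map (Int.castRingHom ℚ)).conductorNorm ℤ) :=
    neZero_conductorNorm_of_isElliptic _
  haveI := minTwist7_isElliptic
  haveI := minTwist7_isGloballyMinimal
  haveI iNZT : NeZero (((⟨0, 1, 1, -114, 130⟩ : WeierstrassCurve ℤ).map (Int.castRingHom ℚ)).conductorNorm ℤ) :=
    neZero_conductorNorm_of_isElliptic _
  haveI iP := Fact.mk (by norm_num : Nat.Prime 5)
  haveI : Fact (Nat.Prime 211) := ⟨by norm_num⟩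
  haveI : NeZero (211 : ℕ) := ⟨by norm_num⟩
  have hsur : ((⟨0, -1, 1, -2, 0⟩ : WeierstrassCurve ℤ).map (Int.castRingHom ℚ)).HasSurjectiveModNGaloisRep ((5 : ℕ) : ℤ) := by
    simpa using hasSurjectiveModNGaloisRep_pow_5 1
  have hC : (⟨1, (2 : ℚ), (0 : ℚ), -((1 : ℚ) / 2)⟩ : WeierstrassCurve.VariableChange ℚ) •
      ((⟨0, 1, 1, -114, 130⟩ : WeierstrassCurve ℤ).map (Int.castRingHom ℚ)) =
      ((⟨0, -1, 1, -2, 0⟩ : WeierstrassCurve ℤ).map (Int.castRingHom ℚ)).quadraticTwist ((NumberField.discr K : ℤ) : ℚ) := by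
    rw [hD]; push_cast; exact minTwist7_smul_eq
  have hpD : ¬ (((5 : ℕ) : ℤ) ∣ NumberField.discr K) := by rw [hD]; decide
  have hiff := kolyvaginPrime_iff_twistKuriharaBit_5_neg7 h372 h84 hKim hSak1 hSak2 hnf hMaz K hK hD hδE
  constructor
  · intro hbit D hc hu
    have hT := (natCard_selmerGroup_quadraticTwist_le_iff_kuriharaBit hKim hSak1 hSak2 hnf hMaz _ 5 le_rfl goodOrdinary_5.1
      goodOrdinary_5.2 hsur (NumberField.discr_ne_zero K) hpD _ _ hC minTwist7_nonAnomalous_5 minTwist7_kodairaNeron_5 1).mpr (hiff.mp hbit)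
    rw [pow_one] at hT
    exact twistKuriharaClaim_prime_of_natCard_selmerGroup_le hSak3 _ 5 le_rfl goodOrdinary_5.1 goodOrdinary_5.2 hsur
      (NumberField.discr_ne_zero K) hpD _ _ hC minTwist7_nonAnomalous_5 minTwist7_kodairaNeron_5 hT 211
      minTwist7_isCyclicKolyvaginLevel_5_211 _ minTwist7_localNondivisible_211 D hc hu
  · intro hunit
    refine hiff.mpr fun D hc hu ↦ ?_
    obtain ⟨ψ, hψ, hne⟩ := hunit D hc hu
    refine ⟨211, inferInstance, minTwist7_isCyclicKolyvaginLevel_5_211, ?_, ψ, hψ, hne⟩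
    rw [Nat.Prime.primeFactors (by norm_num), Finset.card_singleton]

/-- **AGREEMENT of the two decisive primes of row `709a1` @ `(5, -7)`: `δ̃_71(T₀)` is a unit ⟺ `δ̃_211(T₀)` is a unit**
(for every admissible datum; each side is ⟺ the row's bit — `twistKuriharaBit_iff_unit_71` of `…KuriharaDecisive709a1` and
`twistKuriharaBit_iff_unit_211` above). A fleet computation returning a unit at one and a zero at the other contradicts the print
facts named (or the engine). CONDITIONAL on the named facts and the E-side claim; per curve; BSD is not proved by it.
[cite: Sakamoto2022pSelmer, Lemma 4.4, Lemma 4.6 (1)] [cite: Kim2022StructureSelmer, Thm. 1.11] -/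
theorem unit_71_iff_unit_211
    (h372 : GrossLMS1991.prop37_2_frobeniusCongruence)
    (h84 : Literature.NumberTheory.EllipticCurves.WZhang2014_lemma84_exists_minimal_kolyvaginClass_one_selmerCard)
    (hKim : Kim2022_card_selmerGroup_le_pow_of_kuriharaNumber_ne_zero)
    (hSak1 : Sakamoto2022_card_selmerGroup_eq_pow_of_isDeltaMinimal)
    (hSak2 : Sakamoto2022_exists_cyclicLevel_kuriharaNumber_ne_zero)
    (hSak3 : Literature.NumberTheory.EllipticCurves.Sakamoto2022_kuriharaNumber_prime_ne_zero_of_localNondivisible)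
    (hnf : exists_isNewformOf) (hMaz : mazur_not_dvd_maninConstant_of_odd)
    (K : Type) [Field K] [NumberField K] (hK : IsImaginaryQuadratic K) (hD : NumberField.discr K = -7)
    (hδE : haveI := isElliptic_c709a1; haveI := isGloballyMinimal_c709a1;
      haveI : NeZero (((⟨0, -1, 1, -2, 0⟩ : WeierstrassCurve ℤ).map (Int.castRingHom ℚ)).conductorNorm ℤ) := neZero_conductorNorm_of_isElliptic _;
      haveI := Fact.mk (by norm_num : Nat.Prime 5);
      ∀ (D : ModularParametrizationData ((⟨0, -1, 1, -2, 0⟩ : WeierstrassCurve ℤ).map (Int.castRingHom ℚ)) (((⟨0, -1, 1, -2, 0⟩ : WeierstrassCurve ℤ).map (Int.castRingHom ℚ)).conductorNorm ℤ)), ¬ ((5 : ℕ) : ℤ) ∣ D.maninConstant →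
        (∃ u : ℚ, ‖(u : ℚ_[5])‖ = 1 ∧ ((⟨0, -1, 1, -2, 0⟩ : WeierstrassCurve ℤ).map (Int.castRingHom ℚ)).realPeriodRat = u * plusPeriod D.f) →
        ∃ ψ : (ℓ : ℕ) → (ZMod ℓ)ˣ →* Multiplicative (ZMod 5),
          (∀ ℓ ∈ (7171 : ℕ).primeFactors, Function.Surjective (ψ ℓ)) ∧ kuriharaNumber D.f 5 7171 ψ ≠ 0) :
    haveI := isElliptic_c709a1; haveI := isGloballyMinimal_c709a1;
    haveI : NeZero (((⟨0, -1, 1, -2, 0⟩ : WeierstrassCurve ℤ).map (Int.castRingHom ℚ)).conductorNorm ℤ) := neZero_conductorNorm_of_isElliptic _;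
    haveI := minTwist7_isElliptic; haveI := minTwist7_isGloballyMinimal;
    haveI : NeZero (((⟨0, 1, 1, -114, 130⟩ : WeierstrassCurve ℤ).map (Int.castRingHom ℚ)).conductorNorm ℤ) := neZero_conductorNorm_of_isElliptic _;
    haveI := Fact.mk (by norm_num : Nat.Prime 5);
    (∀ (D : ModularParametrizationData ((⟨0, 1, 1, -114, 130⟩ : WeierstrassCurve ℤ).map (Int.castRingHom ℚ))
          (((⟨0, 1, 1, -114, 130⟩ : WeierstrassCurve ℤ).map (Int.castRingHom ℚ)).conductorNorm ℤ)),
        ¬ ((5 : ℕ) : ℤ) ∣ D.maninConstant →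
        (∃ u : ℚ, ‖(u : ℚ_[5])‖ = 1 ∧
          ((⟨0, 1, 1, -114, 130⟩ : WeierstrassCurve ℤ).map (Int.castRingHom ℚ)).realPeriodRat = u * plusPeriod D.f) →
        ∃ ψ : (q : ℕ) → (ZMod q)ˣ →* Multiplicative (ZMod 5),
          (∀ q ∈ (71 : ℕ).primeFactors, Function.Surjective (ψ q)) ∧ kuriharaNumber D.f 5 71 ψ ≠ 0) ↔
    (∀ (D : ModularParametrizationData ((⟨0, 1, 1, -114, 130⟩ : WeierstrassCurve ℤ).map (Int.castRingHom ℚ))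
          (((⟨0, 1, 1, -114, 130⟩ : WeierstrassCurve ℤ).map (Int.castRingHom ℚ)).conductorNorm ℤ)),
        ¬ ((5 : ℕ) : ℤ) ∣ D.maninConstant →
        (∃ u : ℚ, ‖(u : ℚ_[5])‖ = 1 ∧
          ((⟨0, 1, 1, -114, 130⟩ : WeierstrassCurve ℤ).map (Int.castRingHom ℚ)).realPeriodRat = u * plusPeriod D.f) →
        ∃ ψ : (q : ℕ) → (ZMod q)ˣ →* Multiplicative (ZMod 5),
          (∀ q ∈ (211 : ℕ).primeFactors, Function.Surjective (ψ q)) ∧ kuriharaNumber D.f 5 211 ψ ≠ 0) :=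
  (twistKuriharaBit_iff_unit_71 h372 h84 hKim hSak1 hSak2 hSak3 hnf hMaz K hK hD hδE).symm.trans
    (twistKuriharaBit_iff_unit_211 h372 h84 hKim hSak1 hSak2 hSak3 hnf hMaz K hK hD hδE)

end C709a1

end Summit.BirchSwinnertonDyer.BirchSwinnertonDyer.Theorems.KolyvaginDepthDoor

end
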